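import Mathlib

/-!
# SoloBlind — resonant residue sums (finitary core of THEOREM W′(c), window-height §12.9′)

Solo/blind artefact (unit `solo-RiemannHypothesis-blind`, claim C75/C76).  MODEL statement, no bearing on
`RiemannHypothesis` itself.

In the lattice-sampling model of §12 the odd two-edge arcsine window family, read at lattice density
`1 + η = q/p`, has the scaling-limit visibility criterion
`(1/q) · Σ_{r<q} A(cos²(π r/q); s) > 1`, `s = sinh² x`, where the site gain at design phase with
`cos² = c` is

`A(c; s) = [2 s c − (1+2s)(1−c)]₊ + [2 s (1−c) − (1+2s) c]₊ .`

This file certifies the RESONANT VALUES quoted in §12.9′ for the densities whose residues have rational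
`cos²`: `q = 1, 2` (average `2s`, threshold `s = 1/2`, i.e. `x = arsinh 2^{-1/2}` = U′), `q = 3` and `q = 6`
(threshold `s = 7/8`), `q = 4` (threshold `s = 1`), together with the channel-form identity
`A(c;s) = [c(1+4s) − (1+2s)]₊ + [2s − c(1+4s)]₊` (at most one channel alive) and the exact depth values
`2·sinh²(arsinh(√2/2)) = 1`, `sinh²(arsinh √(7/8)) = 7/8`.
-/

namespace Summit.RiemannHypothesis.RiemannHypothesis.Theorems

noncomputable section

/-- Site gain of the odd two-edge arcsine family at a design phase with `cos² θ = c`, depth `s = sinh² x`. -/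
def soloBlindResGain (c s : ℝ) : ℝ :=
  max (2*s*c - (1+2*s)*(1-c)) 0 + max (2*s*(1-c) - (1+2*s)*c) 0

/-- Channel form: with `u = c(1+4s)` the two channels are `[u − (1+2s)]₊` and `[2s − u]₊`. -/
theorem soloBlindResGain_channels (c s : ℝ) :
    soloBlindResGain c s = max (c*(1+4*s) - (1+2*s)) 0 + max (2*s - c*(1+4*s)) 0 := by
  unfold soloBlindResGain
  congr 1 <;> congr 1 <;> ring

/-- At most one channel is alive: if the in-band channel is nonnegative the out-of-band one is negative. -/
theorem soloBlind_channels_exclusive (c s : ℝ) (h : 0 ≤ c*(1+4*s) - (1+2*s)) :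
    2*s - c*(1+4*s) < 0 := by linarith

/-- Critical residue (`θ = 0`, `c = 1`): gain `2s`. -/
theorem soloBlindResGain_one (s : ℝ) (hs : 0 ≤ s) : soloBlindResGain 1 s = 2*s := by
  rw [soloBlindResGain_channels]
  rw [max_eq_left (by linarith), max_eq_right (by linarith)]
  ring

/-- Half-shifted residue (`θ = π/2`, `c = 0`): channels swap, gain again `2s` (the heart of THEOREM W′). -/
theorem soloBlindResGain_zero (s : ℝ) (hs : 0 ≤ s) : soloBlindResGain 0 s = 2*s := by
  rw [soloBlindResGain_channels]
  rw [max_eq_right (by linarith), max_eq_left (by linarith)]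
  ring

/-- Residues with `cos² = 1/4` (θ = π/3, 2π/3): gain `s − 1/4` once `s ≥ 1/4`. -/
theorem soloBlindResGain_quarter (s : ℝ) (hs : 1/4 ≤ s) : soloBlindResGain (1/4) s = s - 1/4 := by
  rw [soloBlindResGain_channels]
  rw [max_eq_right (by linarith), max_eq_left (by linarith)]
  ring

/-- Residues with `cos² = 3/4` (θ = π/6, 5π/6): gain `s − 1/4` once `s ≥ 1/4`. -/
theorem soloBlindResGain_threeQuarter (s : ℝ) (hs : 1/4 ≤ s) :
    soloBlindResGain (3/4) s = s - 1/4 := by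
  rw [soloBlindResGain_channels]
  rw [max_eq_left (by linarith), max_eq_right (by linarith)]
  ring

/-- Residues with `cos² = 1/2` (θ = π/4, 3π/4): both channels dead, gain `0`, at every depth. -/
theorem soloBlindResGain_half (s : ℝ) : soloBlindResGain (1/2) s = 0 := by
  rw [soloBlindResGain_channels]
  rw [max_eq_right (by linarith), max_eq_right (by linarith)]
  ring

/-- `q = 1` (critical density, THEOREM W) and `q = 2` (twice critical, THEOREM W′) have the SAME residue
average `2s`; the criterion `2s > 1` is `s > 1/2`. -/
theorem soloBlind_resAvg_q1_q2 (s : ℝ) (hs : 0 ≤ s) :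
    soloBlindResGain 1 s = 2*s ∧ (soloBlindResGain 1 s + soloBlindResGain 0 s) / 2 = 2*s ∧
      (1 < 2*s ↔ 1/2 < s) := by
  refine ⟨soloBlindResGain_one s hs, ?_, ?_⟩
  · rw [soloBlindResGain_one s hs, soloBlindResGain_zero s hs]; ring
  · constructor <;> intro h <;> linarith

/-- `q = 3` (densities `3/p`): residue average `(4s − 1/2)/3`; criterion `> 1` iff `s > 7/8`. -/
theorem soloBlind_resAvg_q3 (s : ℝ) (hs : 1/4 ≤ s) :
    (soloBlindResGain 1 s + soloBlindResGain (1/4) s + soloBlindResGain (1/4) s) / 3 = (4*s - 1/2) / 3 ∧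
      (1 < (4*s - 1/2) / 3 ↔ 7/8 < s) := by
  refine ⟨?_, ?_⟩
  · rw [soloBlindResGain_one s (by linarith), soloBlindResGain_quarter s hs]; ring
  · constructor <;> intro h <;> linarith

/-- `q = 4` (densities `4/p`): residue average `s`; criterion `> 1` iff `s > 1` (this resonance HURTS:
`arsinh 1 = 0.8814 > x_B`). -/
theorem soloBlind_resAvg_q4 (s : ℝ) (hs : 0 ≤ s) :
    (soloBlindResGain 1 s + soloBlindResGain (1/2) s + soloBlindResGain 0 s + soloBlindResGain (1/2) s) / 4
      = s := by
  rw [soloBlindResGain_one s hs, soloBlindResGain_half, soloBlindResGain_zero s hs]; ring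

/-- `q = 6` (densities `6/p`): residue average `(8s − 1)/6`; criterion `> 1` iff `s > 7/8` — the same
threshold as `q = 3`. -/
theorem soloBlind_resAvg_q6 (s : ℝ) (hs : 1/4 ≤ s) :
    (soloBlindResGain 1 s + soloBlindResGain (3/4) s + soloBlindResGain (1/4) s + soloBlindResGain 0 s
        + soloBlindResGain (1/4) s + soloBlindResGain (3/4) s) / 6 = (8*s - 1) / 6 ∧
      (1 < (8*s - 1) / 6 ↔ 7/8 < s) := by
  refine ⟨?_, ?_⟩
  · rw [soloBlindResGain_one s (by linarith), soloBlindResGain_threeQuarter s hs,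
      soloBlindResGain_quarter s hs, soloBlindResGain_zero s (by linarith)]
    ring
  · constructor <;> intro h <;> linarith

/-- The U′ depth: `x_U = arsinh(√2/2) = arsinh 2^{-1/2}` is exactly where `2 sinh² x = 1`. -/
theorem soloBlind_xU_depth : 2 * Real.sinh (Real.arsinh (Real.sqrt 2 / 2)) ^ 2 = 1 := by
  rw [Real.sinh_arsinh, div_pow, Real.sq_sqrt (by norm_num : (0:ℝ) ≤ 2)]
  norm_num

/-- The `q = 3, 6` resonant depth: `sinh²(arsinh √(7/8)) = 7/8` (`x = 0.83496…`). -/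
theorem soloBlind_q3_depth : Real.sinh (Real.arsinh (Real.sqrt (7/8))) ^ 2 = 7/8 := by
  rw [Real.sinh_arsinh, Real.sq_sqrt (by norm_num : (0:ℝ) ≤ 7/8)]

/-- Depth is monotone: `sinh² ` is strictly increasing on `[0, ∞)`, so each criterion `s > s₀` is a
depth threshold `x > arsinh √s₀`. -/
theorem soloBlind_depth_strictMono (x y : ℝ) (hx : 0 ≤ x) (hxy : x < y) :
    Real.sinh x ^ 2 < Real.sinh y ^ 2 := by
  have h0 : 0 ≤ Real.sinh x := Real.sinh_nonneg_iff.mpr hx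
  have h1 : Real.sinh x < Real.sinh y := Real.sinh_lt_sinh.mpr hxy
  nlinarith

end

end Summit.RiemannHypothesis.RiemannHypothesis.Theorems
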